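import Summits.QuantumFields.YangMills.Theorems.VirialFluxGapCentralFieldSlotDerivative
import HarnessLib

/-!
# Route `VirialFluxGap` (YangMills): the explicit central field along the own frame curves of a SEAM variable — derivatives of its three half-Pauli coordinates
# and their exact trace (seam twin of ✓`VirialFluxGapCentralFieldSlotDerivative`; central chart C1 of ⟨stmt-QuantumFields-24141⟩; free-hands helper)

Width seat `ym-line-sfw-p2-w3` g59 (cell ym-idea-1, free hands), `--supports stmt-QuantumFields-24141`.

The seam block of the explicit central field `X_c = X_z + U` (LEAD ruling (A), 2026-08-31): at the seam variable `x` the direction is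
`quatMatrix(0, Im(conj(lift σ₄ z₄)·q(P.2 x)) + ½σ₄ z₄)`, `z₄ = seamIm P` (block of `N = L³` variables).  Verbatim twin of the wrap-block file:
* §1 `centralDir_inr` (the seam-slot formula at all coordinates), `exists_seamRead_clm`, ★ `hasDerivAt_seamIm_seamCurve` (`ż_b = Im_b(q·p)/L³`),
  ★ `hasDerivAt_seamQuat_seamCurve` (`q̇ = q·p`);
* §2 `centralCoord_seam_eq`, ★★ `hasDerivAt_centralCoord_seam` (the clamp is the lift near `s = 0`);
* §3 ★★★ `centralCoord_seam_trace` — `V₀ + V₁ + V₂ = 3(σ₄ r q₀ + z·p) − L⁻³(3q₀² + 2|p|² + σ₄ r⁻¹ q₀ (z·p)) + (3/2)σ₄ q₀/L³` (✓`centralCoord_trace_algebra`);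
* §4 `mulTangent_stdFrame_inr`, `frameD_stdFrame_inr_eq_of_hasDerivAt`, ★★★ `centralDiv_seam_eq` (frame form under differentiability of the coordinates).

HONEST LABEL: calculus for the seam variables; the sum over all variables, (E2) and (E1) are NOT here; ⟨24141⟩ and ⟨22884⟩ stay OPEN; the Yang–Mills mass gap is NOT proved
by this; no summit is proved by a line.  THEOREMS ONLY (no `def`, no `sorry`).

References: [cite: CosteEtAl1985]; [cite: arXiv220412737, §2 (2.4) (p. 10)].
-/

set_option autoImplicit false

noncomputable section

open scoped Matrix BigOperators Quaternion Topology
open Literature.MathematicalPhysics.QuantumFieldTheory hiding SU2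
open Literature.MathematicalPhysics.QuantumLattice
open Literature.MathematicalPhysics.QuantumFieldTheory.SUNBakryEmery (matTop)

namespace Summit.QuantumFields.YangMills.Theorems.VirialFluxGap.CentralField

open Summit.QuantumFields.YangMills.Theorems.FemtoTransferGap
open Summit.QuantumFields.YangMills.Theorems.VirialFluxGap.RingDeficit
open Summit.QuantumFields.YangMills.Theorems.VirialFluxGap.FrameDerivative
open Summit.QuantumFields.YangMills.Theorems.VirialFluxGap.FrameHessian
open Summit.QuantumFields.YangMills.Theorems.VirialFluxGap.FixFrame

variable {L : ℕ} [NeZero L]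

open scoped Matrix.Norms.Frobenius

attribute [local instance 2000] Literature.MathematicalPhysics.QuantumFieldTheory.SUNBakryEmery.matTop

/-! ## §1 Letters and the moving quantities along a seam frame curve -/

/-- The seam-slot formula of the central direction at ALL coordinates. [cite: CosteEtAl1985] -/
theorem centralDir_inr (σ : Fin 3 → ℝ) (σ₄ : ℝ)
    (M : (Fin (2 * L - 1 + 1) → Edge 3 L → Matrix (Fin 2) (Fin 2) ℂ) × (Site 3 L → Matrix (Fin 2) (Fin 2) ℂ)) (x : Site 3 L) :
    centralDir L σ σ₄ M (Sum.inr x) =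
      quatMatrix ⟨0,
        anchoredIm (clampLift σ₄ (seamAvgM L M)) (M.2 x) 0 + (1 / 2 : ℝ) * σ₄ * seamAvgM L M 0,
        anchoredIm (clampLift σ₄ (seamAvgM L M)) (M.2 x) 1 + (1 / 2 : ℝ) * σ₄ * seamAvgM L M 1,
        anchoredIm (clampLift σ₄ (seamAvgM L M)) (M.2 x) 2 + (1 / 2 : ℝ) * σ₄ * seamAvgM L M 2⟩ := by
  rw [centralDir]

/-- The seam slot quaternion as a continuous linear map of the coordinates. [folklore] -/
theorem exists_seamRead_clm (x : Site 3 L) :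
    ∃ ρ : ((Fin (2 * L - 1 + 1) → Edge 3 L → Matrix (Fin 2) (Fin 2) ℂ) × (Site 3 L → Matrix (Fin 2) (Fin 2) ℂ)) →L[ℝ] ℍ, ∀ M, ρ M = readQuat (M.2 x) :=
  ⟨LinearMap.toContinuousLinearMap
    { toFun := fun M => readQuat (M.2 x), map_add' := fun M N => by ext <;> simp [readQuat], map_smul' := fun c M => by ext <;> simp [readQuat] },
    fun _ => rfl⟩

/-- ★ **The seam average along a seam frame curve**: each component of `z₄` moves with velocity `Im_b(su2Quat(P.2 x (t))·p)/L³`. [cite: arXiv220412737, §2 (2.4) (p. 10)] -/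
theorem hasDerivAt_seamIm_seamCurve (x : Site 3 L) (p : ℍ) (hY : (quatMatrix p)ᴴ = -quatMatrix p) (hY0 : (quatMatrix p).trace = 0)
    (P : (Fin (2 * L - 1 + 1) → GaugeConfig 3 L SU2) × (Site 3 L → SU2)) (t : ℝ) :
    HasDerivAt (fun s => seamIm L (P * seamCurve x hY hY0 s) 0) ((su2Quat ((P * seamCurve x hY hY0 t).2 x) * p).imI / ((L : ℝ) ^ 3)) t ∧
    HasDerivAt (fun s => seamIm L (P * seamCurve x hY hY0 s) 1) ((su2Quat ((P * seamCurve x hY hY0 t).2 x) * p).imJ / ((L : ℝ) ^ 3)) t ∧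
    HasDerivAt (fun s => seamIm L (P * seamCurve x hY hY0 s) 2) ((su2Quat ((P * seamCurve x hY hY0 t).2 x) * p).imK / ((L : ℝ) ^ 3)) t := by
  have key : ∀ b : Fin 3, HasDerivAt (fun s => seamIm L (P * seamCurve x hY hY0 s) b)
      ((![(su2Quat ((P * seamCurve x hY hY0 t).2 x) * p).imI, (su2Quat ((P * seamCurve x hY hY0 t).2 x) * p).imJ,
          (su2Quat ((P * seamCurve x hY hY0 t).2 x) * p).imK] : Fin 3 → ℝ) b / ((L : ℝ) ^ 3)) t := by
    intro b
    obtain ⟨ℓ, hℓ, hφ⟩ := exists_zseamCoeff_clm (L := L) 2 b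
    have heq : (fun s => seamIm L (P * seamCurve x hY hY0 s) b) = fun s => ℓ (ringCoord L (P * seamCurve x hY hY0 s)) := by
      funext s
      rw [← hφ, zseamCoeff_eq_seamIm]; ring
    rw [heq]
    have h := hasDerivAt_comp_ringCoord_seamCurve (L := L) ℓ.contDiff x hY hY0 P t
    refine h.congr_deriv ?_
    rw [ℓ.fderiv, hℓ, sum_imEntry_seamTangent, imEntry_coe_mul_quatMatrix]
    ring
  refine ⟨?_, ?_, ?_⟩
  · simpa using key 0
  · simpa using key 1
  · simpa using key 2

/-- ★ **The seam quaternion along its own frame curve**: `d/ds su2Quat((P·γ(s)).2 x) = su2Quat(…)·p`. [cite: arXiv220412737, §2 (2.4) (p. 10)] -/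
theorem hasDerivAt_seamQuat_seamCurve (x : Site 3 L) (p : ℍ) (hY : (quatMatrix p)ᴴ = -quatMatrix p) (hY0 : (quatMatrix p).trace = 0)
    (P : (Fin (2 * L - 1 + 1) → GaugeConfig 3 L SU2) × (Site 3 L → SU2)) (t : ℝ) :
    HasDerivAt (fun s => su2Quat ((P * seamCurve x hY hY0 s).2 x)) (su2Quat ((P * seamCurve x hY hY0 t).2 x) * p) t := by
  obtain ⟨ρ, hρ⟩ := exists_seamRead_clm (L := L) x
  have heq : (fun s => su2Quat ((P * seamCurve x hY hY0 s).2 x)) = fun s => ρ (ringCoord L (P * seamCurve x hY hY0 s)) := by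
    funext s; rw [hρ]; rfl
  rw [heq]
  have h := ρ.hasFDerivAt.comp_hasDerivAt t (hasDerivAt_ringCoord_seamCurve x hY hY0 P t)
  refine h.congr_deriv ?_
  show ρ (seamTangent x (quatMatrix p) (P * seamCurve x hY hY0 t)) = _
  rw [hρ]
  show readQuat (((P * seamCurve x hY hY0 t).2 x : Matrix (Fin 2) (Fin 2) ℂ) * seamDir x (quatMatrix p) x) = _
  rw [seamDir_self, readQuat_coe_mul_quatMatrix]

/-! ## §2 The coordinates of the central direction along the own seam curve -/

omit [NeZero L] in
/-- `seamCurve` does not depend on the proofs, only on the direction. [folklore] -/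
theorem seamCurve_congr (x : Site 3 L) {Y Y' : Matrix (Fin 2) (Fin 2) ℂ} (h : Y = Y') (hY : Yᴴ = -Y) (hY0 : Y.trace = 0)
    (hY' : Y'ᴴ = -Y') (hY0' : Y'.trace = 0) (s : ℝ) :
    seamCurve (L := L) x hY hY0 s = seamCurve (L := L) x hY' hY0' s := by
  subst h; rfl

/-- The own-curve value of the `a`-th coordinate of the central direction at a seam variable: twice the `(2−a)`-th anchored entry. [cite: CosteEtAl1985] -/
theorem centralCoord_seam_eq (σ : Fin 3 → ℝ) (σ₄ : ℝ) (Q : (Fin (2 * L - 1 + 1) → GaugeConfig 3 L SU2) × (Site 3 L → SU2)) (x : Site 3 L) :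
    pauliCoord (centralDir L σ σ₄ (ringCoord L Q) (Sum.inr x)) 0 =
      2 * ((star (clampLift σ₄ (seamIm L Q)) * su2Quat (Q.2 x)).imK + (1 / 2 : ℝ) * σ₄ * seamIm L Q 2) ∧
    pauliCoord (centralDir L σ σ₄ (ringCoord L Q) (Sum.inr x)) 1 =
      2 * ((star (clampLift σ₄ (seamIm L Q)) * su2Quat (Q.2 x)).imJ + (1 / 2 : ℝ) * σ₄ * seamIm L Q 1) ∧
    pauliCoord (centralDir L σ σ₄ (ringCoord L Q) (Sum.inr x)) 2 =
      2 * ((star (clampLift σ₄ (seamIm L Q)) * su2Quat (Q.2 x)).imI + (1 / 2 : ℝ) * σ₄ * seamIm L Q 0) := by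
  rw [centralDir_inr σ σ₄ (ringCoord L Q) x, seamAvgM_ringCoord]
  obtain ⟨h0, h1, h2⟩ := pauliCoord_quatMatrix_im
    (anchoredIm (clampLift σ₄ (seamIm L Q)) ((ringCoord L Q).2 x) 0 + (1 / 2 : ℝ) * σ₄ * seamIm L Q 0)
    (anchoredIm (clampLift σ₄ (seamIm L Q)) ((ringCoord L Q).2 x) 1 + (1 / 2 : ℝ) * σ₄ * seamIm L Q 1)
    (anchoredIm (clampLift σ₄ (seamIm L Q)) ((ringCoord L Q).2 x) 2 + (1 / 2 : ℝ) * σ₄ * seamIm L Q 2)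
  rw [h0, h1, h2]
  exact ⟨rfl, rfl, rfl⟩

/-- ★★ **The coordinates of the central direction along the own frame curve of a seam variable** (`|z₄(P)|² < ½`, admissible direction `quatMatrix p`):
derivatives `2·[Im_b(conj(D)·q + conj(c)·q·p) + ½σ₄ ż_b]`, `b = 2, 1, 0`, `q = su2Quat (P.2 x)`, `c = liftQuat σ₄ z₄`, `ż_b = Im_b(q·p)/L³`. [cite: CosteEtAl1985] -/
theorem hasDerivAt_centralCoord_seam (σ : Fin 3 → ℝ) (σ₄ : ℝ) (P : (Fin (2 * L - 1 + 1) → GaugeConfig 3 L SU2) × (Site 3 L → SU2)) (x : Site 3 L)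
    (hz : (seamIm L P 0) ^ 2 + (seamIm L P 1) ^ 2 + (seamIm L P 2) ^ 2 < 1 / 2)
    (p : ℍ) (hY : (quatMatrix p)ᴴ = -quatMatrix p) (hY0 : (quatMatrix p).trace = 0) :
    let z : Fin 3 → ℝ := seamIm L P
    let q : ℍ := su2Quat (P.2 x)
    let dz : Fin 3 → ℝ := ![(q * p).imI / ((L : ℝ) ^ 3), (q * p).imJ / ((L : ℝ) ^ 3), (q * p).imK / ((L : ℝ) ^ 3)]
    HasDerivAt (fun s => pauliCoord (centralDir L σ σ₄ (ringCoord L (P * seamCurve x hY hY0 s)) (Sum.inr x)) 0)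
        (2 * ((star ((-σ₄ * (z 0 * dz 0 + z 1 * dz 1 + z 2 * dz 2) / Real.sqrt (1 - ((z 0) ^ 2 + (z 1) ^ 2 + (z 2) ^ 2))) • (1 : ℍ) + dz 0 • zUnit 0 + dz 1 • zUnit 1 + dz 2 • zUnit 2) * q + star (liftQuat σ₄ z) * (q * p)).imK + (1 / 2 : ℝ) * σ₄ * dz 2)) 0 ∧
    HasDerivAt (fun s => pauliCoord (centralDir L σ σ₄ (ringCoord L (P * seamCurve x hY hY0 s)) (Sum.inr x)) 1)
        (2 * ((star ((-σ₄ * (z 0 * dz 0 + z 1 * dz 1 + z 2 * dz 2) / Real.sqrt (1 - ((z 0) ^ 2 + (z 1) ^ 2 + (z 2) ^ 2))) • (1 : ℍ) + dz 0 • zUnit 0 + dz 1 • zUnit 1 + dz 2 • zUnit 2) * q + star (liftQuat σ₄ z) * (q * p)).imJ + (1 / 2 : ℝ) * σ₄ * dz 1)) 0 ∧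
    HasDerivAt (fun s => pauliCoord (centralDir L σ σ₄ (ringCoord L (P * seamCurve x hY hY0 s)) (Sum.inr x)) 2)
        (2 * ((star ((-σ₄ * (z 0 * dz 0 + z 1 * dz 1 + z 2 * dz 2) / Real.sqrt (1 - ((z 0) ^ 2 + (z 1) ^ 2 + (z 2) ^ 2))) • (1 : ℍ) + dz 0 • zUnit 0 + dz 1 • zUnit 1 + dz 2 • zUnit 2) * q + star (liftQuat σ₄ z) * (q * p)).imI + (1 / 2 : ℝ) * σ₄ * dz 0)) 0 := by
  intro z q dz
  have hγ0 : P * seamCurve x hY hY0 0 = P := by rw [seamCurve_zero, mul_one]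
  obtain ⟨hz0, hz1, hz2⟩ := hasDerivAt_seamIm_seamCurve (L := L) x p hY hY0 P 0
  rw [hγ0] at hz0 hz1 hz2
  have hzb : ∀ b : Fin 3, HasDerivAt (fun s => seamIm L (P * seamCurve x hY hY0 s) b) (dz b) 0 := by
    intro b; fin_cases b
    · simpa [dz] using hz0
    · simpa [dz] using hz1
    · simpa [dz] using hz2
  have hq := hasDerivAt_seamQuat_seamCurve (L := L) x p hY hY0 P 0
  rw [hγ0] at hq
  have hlt : (seamIm L (P * seamCurve x hY hY0 0) 0) ^ 2 + (seamIm L (P * seamCurve x hY hY0 0) 1) ^ 2 + (seamIm L (P * seamCurve x hY hY0 0) 2) ^ 2 < 1 := by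
    rw [hγ0]; linarith
  obtain ⟨hA1, hA2, hA3⟩ := hasDerivAt_anchoredEntry σ₄ (z := fun s => seamIm L (P * seamCurve x hY hY0 s)) hzb hlt hq
  rw [hγ0] at hA1 hA2 hA3
  have hcont : ∀ b : Fin 3, ContinuousAt (fun s => seamIm L (P * seamCurve x hY hY0 s) b) 0 := fun b => (hzb b).continuousAt
  have hev : ∀ᶠ s in 𝓝 (0 : ℝ), (seamIm L (P * seamCurve x hY hY0 s) 0) ^ 2 + (seamIm L (P * seamCurve x hY hY0 s) 1) ^ 2 +
      (seamIm L (P * seamCurve x hY hY0 s) 2) ^ 2 < 1 / 2 := by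
    have hc : ContinuousAt (fun s => (seamIm L (P * seamCurve x hY hY0 s) 0) ^ 2 + (seamIm L (P * seamCurve x hY hY0 s) 1) ^ 2 +
        (seamIm L (P * seamCurve x hY hY0 s) 2) ^ 2) 0 := (((hcont 0).pow 2).add ((hcont 1).pow 2)).add ((hcont 2).pow 2)
    exact hc.eventually_lt continuousAt_const (show _ < (1 / 2 : ℝ) by rw [hγ0]; exact hz)
  have hclamp : ∀ᶠ s in 𝓝 (0 : ℝ), clampLift σ₄ (seamIm L (P * seamCurve x hY hY0 s)) = liftQuat σ₄ (seamIm L (P * seamCurve x hY hY0 s)) :=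
    hev.mono fun s hs => clampLift_eq_liftQuat _ hs.le
  refine ⟨?_, ?_, ?_⟩
  · have hG : HasDerivAt (fun s => 2 * ((star (liftQuat σ₄ (seamIm L (P * seamCurve x hY hY0 s))) * su2Quat ((P * seamCurve x hY hY0 s).2 x)).imK +
        (1 / 2 : ℝ) * σ₄ * seamIm L (P * seamCurve x hY hY0 s) 2))
        (2 * ((star ((-σ₄ * (z 0 * dz 0 + z 1 * dz 1 + z 2 * dz 2) / Real.sqrt (1 - ((z 0) ^ 2 + (z 1) ^ 2 + (z 2) ^ 2))) • (1 : ℍ) + dz 0 • zUnit 0 + dz 1 • zUnit 1 + dz 2 • zUnit 2) * q + star (liftQuat σ₄ z) * (q * p)).imK + (1 / 2 : ℝ) * σ₄ * dz 2)) 0 :=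
      (hA3.add ((hzb 2).const_mul _)).const_mul 2
    refine hG.congr_of_eventuallyEq ?_
    filter_upwards [hclamp] with s hs
    rw [(centralCoord_seam_eq σ σ₄ _ x).1, hs]
  · have hG : HasDerivAt (fun s => 2 * ((star (liftQuat σ₄ (seamIm L (P * seamCurve x hY hY0 s))) * su2Quat ((P * seamCurve x hY hY0 s).2 x)).imJ +
        (1 / 2 : ℝ) * σ₄ * seamIm L (P * seamCurve x hY hY0 s) 1))
        (2 * ((star ((-σ₄ * (z 0 * dz 0 + z 1 * dz 1 + z 2 * dz 2) / Real.sqrt (1 - ((z 0) ^ 2 + (z 1) ^ 2 + (z 2) ^ 2))) • (1 : ℍ) + dz 0 • zUnit 0 + dz 1 • zUnit 1 + dz 2 • zUnit 2) * q + star (liftQuat σ₄ z) * (q * p)).imJ + (1 / 2 : ℝ) * σ₄ * dz 1)) 0 :=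
      (hA2.add ((hzb 1).const_mul _)).const_mul 2
    refine hG.congr_of_eventuallyEq ?_
    filter_upwards [hclamp] with s hs
    rw [(centralCoord_seam_eq σ σ₄ _ x).2.1, hs]
  · have hG : HasDerivAt (fun s => 2 * ((star (liftQuat σ₄ (seamIm L (P * seamCurve x hY hY0 s))) * su2Quat ((P * seamCurve x hY hY0 s).2 x)).imI +
        (1 / 2 : ℝ) * σ₄ * seamIm L (P * seamCurve x hY hY0 s) 0))
        (2 * ((star ((-σ₄ * (z 0 * dz 0 + z 1 * dz 1 + z 2 * dz 2) / Real.sqrt (1 - ((z 0) ^ 2 + (z 1) ^ 2 + (z 2) ^ 2))) • (1 : ℍ) + dz 0 • zUnit 0 + dz 1 • zUnit 1 + dz 2 • zUnit 2) * q + star (liftQuat σ₄ z) * (q * p)).imI + (1 / 2 : ℝ) * σ₄ * dz 0)) 0 :=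
      (hA1.add ((hzb 0).const_mul _)).const_mul 2
    refine hG.congr_of_eventuallyEq ?_
    filter_upwards [hclamp] with s hs
    rw [(centralCoord_seam_eq σ σ₄ _ x).2.2, hs]

/-! ## §3 The trace over the three directions -/

/-- ★★★ **The per-variable divergence of the explicit central field at a seam variable, as own-curve derivatives.**  For `|z₄(P)|² < ½` the three half-Pauli
coordinates of `centralDir` at the seam variable `x` along the own frame curves `P·seamCurve_{x, halfPauli a}` are differentiable at `0` with values `V₀, V₁, V₂`,
and `V₀ + V₁ + V₂ = 3(σ₄ r q₀ + z·p) − L⁻³(3q₀² + 2|p|² + σ₄ r⁻¹ q₀(z·p)) + (3/2)σ₄ q₀/L³` (`q = su2Quat (P.2 x)`, `z = seamIm P`, `r = √(1−|z|²)`). [cite: CosteEtAl1985] -/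
theorem centralCoord_seam_trace (σ : Fin 3 → ℝ) (σ₄ : ℝ) (P : (Fin (2 * L - 1 + 1) → GaugeConfig 3 L SU2) × (Site 3 L → SU2)) (x : Site 3 L)
    (hz : (seamIm L P 0) ^ 2 + (seamIm L P 1) ^ 2 + (seamIm L P 2) ^ 2 < 1 / 2) :
    ∃ V₀ V₁ V₂ : ℝ,
      HasDerivAt (fun s => pauliCoord (centralDir L σ σ₄ (ringCoord L (P * seamCurve x (halfPauli_conjTranspose 0) (halfPauli_trace 0) s)) (Sum.inr x)) 0) V₀ 0 ∧
      HasDerivAt (fun s => pauliCoord (centralDir L σ σ₄ (ringCoord L (P * seamCurve x (halfPauli_conjTranspose 1) (halfPauli_trace 1) s)) (Sum.inr x)) 1) V₁ 0 ∧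
      HasDerivAt (fun s => pauliCoord (centralDir L σ σ₄ (ringCoord L (P * seamCurve x (halfPauli_conjTranspose 2) (halfPauli_trace 2) s)) (Sum.inr x)) 2) V₂ 0 ∧
      V₀ + V₁ + V₂ = 3 * (σ₄ * Real.sqrt (1 - ((seamIm L P 0) ^ 2 + (seamIm L P 1) ^ 2 + (seamIm L P 2) ^ 2)) * (su2Quat (P.2 x)).re + (seamIm L P 0 * (su2Quat (P.2 x)).imI + seamIm L P 1 * (su2Quat (P.2 x)).imJ + seamIm L P 2 * (su2Quat (P.2 x)).imK)) - (3 * (su2Quat (P.2 x)).re ^ 2 + 2 * ((su2Quat (P.2 x)).imI ^ 2 + (su2Quat (P.2 x)).imJ ^ 2 + (su2Quat (P.2 x)).imK ^ 2) + σ₄ * (Real.sqrt (1 - ((seamIm L P 0) ^ 2 + (seamIm L P 1) ^ 2 + (seamIm L P 2) ^ 2)))⁻¹ * (su2Quat (P.2 x)).re * (seamIm L P 0 * (su2Quat (P.2 x)).imI + seamIm L P 1 * (su2Quat (P.2 x)).imJ + seamIm L P 2 * (su2Quat (P.2 x)).imK)) / ((L : ℝ) ^ 3) + (3 / 2 : ℝ)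 * σ₄ * (su2Quat (P.2 x)).re / ((L : ℝ) ^ 3) := by
  obtain ⟨hY2, hY02⟩ := quatMatrix_half_zUnit 2
  obtain ⟨hY1, hY01⟩ := quatMatrix_half_zUnit 1
  obtain ⟨hY0, hY00⟩ := quatMatrix_half_zUnit 0
  obtain ⟨d0, -, -⟩ := hasDerivAt_centralCoord_seam σ σ₄ P x hz ((1 / 2 : ℝ) • zUnit 2) hY2 hY02
  obtain ⟨-, d1, -⟩ := hasDerivAt_centralCoord_seam σ σ₄ P x hz ((1 / 2 : ℝ) • zUnit 1) hY1 hY01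
  obtain ⟨-, -, d2⟩ := hasDerivAt_centralCoord_seam σ σ₄ P x hz ((1 / 2 : ℝ) • zUnit 0) hY0 hY00
  obtain ⟨e0, e1, e2⟩ := halfPauli_eq_quatMatrix_half_zUnit
  rw [show (fun s => pauliCoord (centralDir L σ σ₄ (ringCoord L (P * seamCurve x hY2 hY02 s)) (Sum.inr x)) 0) =
      fun s => pauliCoord (centralDir L σ σ₄ (ringCoord L (P * seamCurve x (halfPauli_conjTranspose 0) (halfPauli_trace 0) s)) (Sum.inr x)) 0
      from funext fun s => by rw [seamCurve_congr x e0]] at d0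
  rw [show (fun s => pauliCoord (centralDir L σ σ₄ (ringCoord L (P * seamCurve x hY1 hY01 s)) (Sum.inr x)) 1) =
      fun s => pauliCoord (centralDir L σ σ₄ (ringCoord L (P * seamCurve x (halfPauli_conjTranspose 1) (halfPauli_trace 1) s)) (Sum.inr x)) 1
      from funext fun s => by rw [seamCurve_congr x e1]] at d1
  rw [show (fun s => pauliCoord (centralDir L σ σ₄ (ringCoord L (P * seamCurve x hY0 hY00 s)) (Sum.inr x)) 2) =
      fun s => pauliCoord (centralDir L σ σ₄ (ringCoord L (P * seamCurve x (halfPauli_conjTranspose 2) (halfPauli_trace 2) s)) (Sum.inr x)) 2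
      from funext fun s => by rw [seamCurve_congr x e2]] at d2
  have hL : (0 : ℝ) < (L : ℝ) := by exact_mod_cast NeZero.pos L
  have hN : ((L : ℝ) ^ 3) ≠ 0 := by positivity
  have hr : Real.sqrt (1 - ((seamIm L P 0) ^ 2 + (seamIm L P 1) ^ 2 + (seamIm L P 2) ^ 2)) ≠ 0 := (Real.sqrt_pos.2 (by linarith)).ne'
  exact ⟨_, _, _, d0, d1, d2, centralCoord_trace_algebra (su2Quat (P.2 x)) (seamIm L P) σ₄ _ hN hr⟩

/-! ## §4 The frame-derivative form -/

/-- The tangent of the standard frame direction `(inr x, a)` at a ring history is the seam tangent of `halfPauli a`. [folklore] -/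
theorem mulTangent_stdFrame_inr (x : Site 3 L) (a : Fin 3) (P : (Fin (2 * L - 1 + 1) → GaugeConfig 3 L SU2) × (Site 3 L → SU2)) :
    mulTangent (stdFrame (Sum.inr x, a)) (ringCoord L P) = seamTangent x (halfPauli a) P := by
  rw [seamTangent_eq]
  unfold mulTangent stdFrame
  refine Prod.ext ?_ ?_
  · funext i' e'
    dsimp only
    simp
  · funext x'
    dsimp only
    simp only [seamDir, Sum.inr.injEq]

/-- ★ From differentiability to the frame derivative along a standard seam direction (uniqueness of derivatives). [folklore] -/
theorem frameD_stdFrame_inr_eq_of_hasDerivAt {f : ((Fin (2 * L - 1 + 1) → Edge 3 L → Matrix (Fin 2) (Fin 2) ℂ) × (Site 3 L → Matrix (Fin 2) (Fin 2) ℂ)) → ℝ}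
    (x : Site 3 L) (a : Fin 3) (P : (Fin (2 * L - 1 + 1) → GaugeConfig 3 L SU2) × (Site 3 L → SU2))
    (hf : DifferentiableAt ℝ f (ringCoord L P)) {V : ℝ}
    (hV : HasDerivAt (fun s => f (ringCoord L (P * seamCurve x (halfPauli_conjTranspose a) (halfPauli_trace a) s))) V 0) :
    frameD (stdFrame (Sum.inr x, a)) f (ringCoord L P) = V := by
  have hγ0 : P * seamCurve x (halfPauli_conjTranspose a) (halfPauli_trace a) 0 = P := by rw [seamCurve_zero, mul_one]
  have hc := hasDerivAt_ringCoord_seamCurve x (halfPauli_conjTranspose a) (halfPauli_trace a) P 0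
  have hf' : HasFDerivAt f (fderiv ℝ f (ringCoord L P)) (ringCoord L (P * seamCurve x (halfPauli_conjTranspose a) (halfPauli_trace a) 0)) := by
    rw [hγ0]; exact hf.hasFDerivAt
  have h := hf'.comp_hasDerivAt (0 : ℝ) hc
  rw [hγ0] at h
  rw [frameD, mulTangent_stdFrame_inr]
  exact h.unique hV

/-- ★★★ **The per-variable divergence of the explicit central field at a seam variable, frame form** (under differentiability of the three coordinates).
[cite: CosteEtAl1985] -/
theorem centralDiv_seam_eq (σ : Fin 3 → ℝ) (σ₄ : ℝ) (P : (Fin (2 * L - 1 + 1) → GaugeConfig 3 L SU2) × (Site 3 L → SU2)) (x : Site 3 L)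
    (hz : (seamIm L P 0) ^ 2 + (seamIm L P 1) ^ 2 + (seamIm L P 2) ^ 2 < 1 / 2)
    (hdiff : ∀ a : Fin 3, DifferentiableAt ℝ (fun M => pauliCoord (centralDir L σ σ₄ M (Sum.inr x)) a) (ringCoord L P)) :
    frameD (stdFrame (Sum.inr x, 0)) (fun M => pauliCoord (centralDir L σ σ₄ M (Sum.inr x)) 0) (ringCoord L P) +
      frameD (stdFrame (Sum.inr x, 1)) (fun M => pauliCoord (centralDir L σ σ₄ M (Sum.inr x)) 1) (ringCoord L P) +
      frameD (stdFrame (Sum.inr x, 2)) (fun M => pauliCoord (centralDir L σ σ₄ M (Sum.inr x)) 2) (ringCoord L P) =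
    3 * (σ₄ * Real.sqrt (1 - ((seamIm L P 0) ^ 2 + (seamIm L P 1) ^ 2 + (seamIm L P 2) ^ 2)) * (su2Quat (P.2 x)).re + (seamIm L P 0 * (su2Quat (P.2 x)).imI + seamIm L P 1 * (su2Quat (P.2 x)).imJ + seamIm L P 2 * (su2Quat (P.2 x)).imK)) - (3 * (su2Quat (P.2 x)).re ^ 2 + 2 * ((su2Quat (P.2 x)).imI ^ 2 + (su2Quat (P.2 x)).imJ ^ 2 + (su2Quat (P.2 x)).imK ^ 2) + σ₄ * (Real.sqrt (1 - ((seamIm L P 0) ^ 2 + (seamIm L P 1) ^ 2 + (seamIm L P 2) ^ 2)))⁻¹ * (su2Quat (P.2 x)).re * (seamIm L P 0 * (su2Quat (P.2 x)).imI + seamIm L P 1 * (su2Quat (P.2 x)).imJ + seamIm L P 2 * (su2Quat (P.2 x)).imK)) / ((L : ℝ) ^ 3) + (3 / 2 : ℝ) * σ₄ * (su2Quat (P.2 x)).re / ((L : ℝ) ^ 3) := by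
  obtain ⟨V₀, V₁, V₂, h0, h1, h2, hsum⟩ := centralCoord_seam_trace σ σ₄ P x hz
  rw [frameD_stdFrame_inr_eq_of_hasDerivAt x 0 P (hdiff 0) h0, frameD_stdFrame_inr_eq_of_hasDerivAt x 1 P (hdiff 1) h1,
    frameD_stdFrame_inr_eq_of_hasDerivAt x 2 P (hdiff 2) h2]
  exact hsum

end Summit.QuantumFields.YangMills.Theorems.VirialFluxGap.CentralField

end
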